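import Literature.AnabelianGeometry.AbsoluteAnabelian.AbsTopISemiAbsolute
import Literature.AnabelianGeometry.AbsoluteAnabelian.GaloisSubextensionProofs
import Literature.AnabelianGeometry.AbsoluteAnabelian.FreeProlRankCompletionProofs
import HarnessLib

/-!
# [AbsTopI] Thm 2.6 (v), (vi) AS TYPED over abstract extensions (`FundamentalExtension.Thm26v`,
# `FundamentalExtension.Thm26vi`; FACT-LIST F-0249 / F-0250): the universal closures are refutable

S. Mochizuki, *Topics in Absolute Anabelian Geometry I: Generalities*, J. Math. Sci. Univ. Tokyo 19
(2012) [MochizukiAbsTopI2012], Thm 2.6 (v), (vi), manuscript p. 22 (lit key `paper:url-11ac98ba15fc`).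

PROOF-ONLY negative-knowledge file (no definition, no instance, no named fact) next to abc-iut-L4-t4's
statement file `AbsTopISemiAbsolute.lean`, abc-iut cell seat abc-iut-f-091 (FACT-LIST rows **F-0249**
`FundamentalExtension.Thm26v`, status `conditional`, and **F-0250** `FundamentalExtension.Thm26vi`, status
`fact-open`; both class `preparatory`, kernel_closedness `parametrised`).

Both rows are PREDICATES on an ABSTRACT extension of profinite groups `1 → Δ → Π → G → 1`
(`E : FundamentalExtension`, plus base data `B : E.MLFBase`, resp. — in the docstring only — "`k` an NF").
The printed theorem is about extensions "of AFG-type or of GSAFG-type", i.e. ARISING FROM a variety / hyperbolic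
orbicurve over `k`; that hypothesis is not part of the typed predicate, so the universal closures over all
abstract extensions are not facts.  This file supplies the kernel objects saying so, by two SPLIT MODELS:

* **F-0249** (`Thm26v B : ζ(Π) = [K : ℚ_p] ∧ Δ = ⋂ {H open | ζ(H) = [Π : H]·ζ(Π)}`): the split extension
  `Π := G_{ℚ_2} × ∏_{q prime} (ℤ_q)^ℕ ↠ G_{ℚ_2}` with MLF base datum `K = ℚ_2` has `δ¹_q(Π) = ∞` for EVERY
  prime `q` (`Π ↠ ℤ_q^n` for all `n`), hence `ζ(Π) = sup_{q,q'} (δ¹_q − δ¹_{q'}) = sup (∞ − ∞) = 0 ≠ 1 = [K : ℚ_2]`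
  (`exists_mlfBase_not_thm26v`, `not_forall_thm26v`).  The witness SPLITS but its `Δ = ∏_q ℤ_q^ℕ` is not
  topologically finitely generated: it misses exactly the regime hypothesis "`Δ` tfg" ([AbsTopI] Prop 2.2)
  of the in-tree CONDITIONAL forms `FundamentalExtension.thm26v_of_coinvariantRankConstant` /
  `thm26v_of_starCondition` (`AbsTopIThm26vProofs.lean`, abc-iut-L4), which remain the forms consumers bind.
* **F-0250** (`Thm26vi : (every continuous Π → ℤ_l kills Δ) ∧ Δ maximal tfg closed normal ∧ Π not tfg`): the
  split extension `Π := G_ℚ × ℤ_2 ↠ G_ℚ` with NF base datum `F = ℚ` SPLITS, has `Δ ≅ ℤ_2` topologically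
  finitely generated (`GeomTFG`), and violates the first clause: the second projection `Π → ℤ_2` is a
  continuous character that is non-trivial on `Δ` (`exists_nfBase_not_thm26vi`, `not_forall_nfBase_thm26vi`,
  `not_forall_thm26vi`).  So the residual hypothesis `hT` ("`T_l(A)/G = 0`": every `Π`-invariant continuous
  character `Δ → ℤ_l` is trivial) of the in-tree conditional form
  `FundamentalExtension.thm26vi_of_tfgNormalSubgroup_trivial` / `NFBase.thm26vi_of_invariantCharacters_trivial`
  (`AbsTopIThm26viProofs.lean`, `AbsTopIThm26Thm214RekeyedProofs.lean`) CANNOT be dropped, even given an NF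
  base, splitting and `Δ` tfg.

Helper facts of independent use: `freeProlRank_eq_top_of_surjective` (`Π ↠ ℤ_l^ℕ ⇒ δ¹_l(Π) = ∞`, via
abc-iut-L4's unfolding lemma `le_freeProlRank_of_surjective` of `FreeProlRankCompletionProofs.lean`),
`zetaInv_eq_zero_of_forall_freeProlRank_eq_top`, `FundamentalExtension.not_thm26v_of_zetaInv_eq_zero`,
`FundamentalExtension.not_thm26vi_of_apply_ne_one`.

FACT-LIST class for both rows: «universal closure REFUTED / schema; instance (conditional) forms in tree».
HONEST FRAMING: [AbsTopI] is a refereed, undisputed paper and nothing here says its Thm 2.6 is wrong — the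
witnesses are abstract split extensions that do not arise from curves; nothing here bears on the disputed
[IUTchIII] Cor. 3.12 or takes a side on any author; refuted-as-typed-universally is never a fact about print.
-/

noncomputable section

open Topology

universe u

namespace Literature.AnabelianGeometry.AbsoluteAnabelian

/-! ## Free pro-`l` rank and `ζ` of groups with large abelian quotients -/

section Ranks

variable {G : Type u} [Group G] [TopologicalSpace G]

/-- `δ¹_l(G) = ∞` as soon as `G` surjects continuously onto `ℤ_l^ℕ`: restricting to the first `n`
coordinates gives continuous surjections `G ↠ ℤ_l^n` for every `n`. [cite: MochizukiAbsTopI2012, Thm 2.6 p.21] -/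
theorem freeProlRank_eq_top_of_surjective (l : ℕ) [Fact l.Prime]
    (f : G →ₜ* Multiplicative (ℕ → ℤ_[l])) (hf : Function.Surjective f) :
    freeProlRank G l = ⊤ := by
  refine ENat.eq_top_iff_forall_ge.mpr fun n => ?_
  -- restriction to the first `n` coordinates, `ℤ_l^ℕ ↠ ℤ_l^n`
  let r : Multiplicative (ℕ → ℤ_[l]) →ₜ* Multiplicative (Fin n → ℤ_[l]) :=
    { toFun := fun x => Multiplicative.ofAdd fun i => Multiplicative.toAdd x i.1
      map_one' := rfl
      map_mul' := fun _ _ => rfl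
      continuous_toFun :=
        continuous_ofAdd.comp (continuous_pi fun i => (continuous_apply _).comp continuous_toAdd) }
  have hr_apply : ∀ (x : Multiplicative (ℕ → ℤ_[l])) (i : Fin n),
      Multiplicative.toAdd (r x) i = Multiplicative.toAdd x i.1 := fun _ _ => rfl
  have hr : Function.Surjective r := by
    intro y
    refine ⟨Multiplicative.ofAdd fun k => if h : k < n then Multiplicative.toAdd y ⟨k, h⟩ else 0,
      Multiplicative.toAdd.injective (funext fun i => ?_)⟩
    rw [hr_apply, toAdd_ofAdd, dif_pos i.2]
  exact le_freeProlRank_of_surjective l (r.comp f) (hr.comp hf)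

/-- If `δ¹_l(G) = ∞` for every prime `l`, then `ζ(G) = sup_{p,p'} (δ¹_p(G) − δ¹_{p'}(G)) = 0` — in the
typed `ℕ∞`-arithmetic of `zetaInv` one has `∞ − ∞ = 0` (print defines `ζ` only "whenever `δ¹_l(H) < ∞` for
all `l`"). [cite: MochizukiAbsTopI2012, Thm 2.6 p.21] -/
theorem zetaInv_eq_zero_of_forall_freeProlRank_eq_top
    (h : ∀ (l : ℕ) [Fact l.Prime], freeProlRank G l = ⊤) : zetaInv G = 0 := by
  unfold zetaInv
  refine ENat.iSup_eq_zero.mpr fun p => ENat.iSup_eq_zero.mpr fun p' => ?_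
  rw [@h p.1 ⟨p.2⟩, @h p'.1 ⟨p'.2⟩, ENat.sub_top]

end Ranks

namespace FundamentalExtension

/-! ## F-0249: `Thm26v` -/

/-- No extension with `ζ(Π) = 0` satisfies the typed Thm 2.6 (v): its first clause is `ζ(Π) = [K : ℚ_p] ≥ 1`.
[cite: MochizukiAbsTopI2012, Thm 2.6 (v) p.22] -/
theorem not_thm26v_of_zetaInv_eq_zero (E : FundamentalExtension.{u}) (B : E.MLFBase)
    (h : zetaInv E.arith = 0) : ¬ E.Thm26v B := by
  rintro ⟨h1, -⟩
  letI := B.instPrime; letI := B.instField; letI := B.instAlgebra; letI := B.instFinite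
  rw [h] at h1
  have h0 : Module.finrank ℚ_[B.p] B.K = 0 := by exact_mod_cast h1.symm
  exact Module.finrank_pos.ne' h0

/-- **F-0249, a model violating the typed Thm 2.6 (v).**  The SPLIT extension
`Π := G_{ℚ_2} × ∏_{q prime} (ℤ_q)^ℕ ↠ G_{ℚ_2}` (first projection) with MLF base datum `K = ℚ_2` splits over
all of `G`, has `ζ(Π) = 0` (every `δ¹_q(Π) = ∞`: project onto the factor `(ℤ_q)^ℕ`), and hence violates
`E.Thm26v B` (`ζ(Π) ≠ 1 = [ℚ_2 : ℚ_2]`).  Honest label: `Δ = ∏_q ℤ_q^ℕ` is not topologically finitely generated —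
the witness lies outside the regime "`Δ` tfg" of Prop 2.2 / `thm26v_of_coinvariantRankConstant`.
[cite: MochizukiAbsTopI2012, Thm 2.6 (v) p.22] -/
theorem exists_mlfBase_not_thm26v :
    ∃ (E : FundamentalExtension.{0}) (B : E.MLFBase),
      E.SplitsOverOpenSubgroup ∧ zetaInv E.arith = 0 ∧ ¬ E.Thm26v B := by
  have _inst : ∀ q : Nat.Primes, Fact (q : ℕ).Prime := fun q => ⟨q.2⟩
  -- the model
  let A : Type := ∀ q : Nat.Primes, Multiplicative (ℕ → ℤ_[(q : ℕ)])
  let Γ : Type := Field.absoluteGaloisGroup ℚ_[2]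
  let E : FundamentalExtension.{0} :=
    { arith := ProfiniteGrp.of (Γ × A)
      gal := absoluteGaloisGrp ℚ_[2]
      aug := ContinuousMonoidHom.fst Γ A
      aug_surjective := fun g => ⟨(g, 1), rfl⟩ }
  let B : E.MLFBase := { p := 2, K := ℚ_[2], galIso := ContinuousMulEquiv.refl _ }
  have hζ : zetaInv E.arith = 0 := by
    refine zetaInv_eq_zero_of_forall_freeProlRank_eq_top fun l hl => ?_
    -- `Π ↠ (ℤ_l)^ℕ`: second projection, then the `l`-component
    let q : Nat.Primes := ⟨l, hl.out⟩
    let π : (Γ × A) →ₜ* Multiplicative (ℕ → ℤ_[l]) :=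
      ⟨(Pi.evalMonoidHom (fun q : Nat.Primes => Multiplicative (ℕ → ℤ_[(q : ℕ)])) q).comp
          (MonoidHom.snd Γ A),
        (continuous_apply q).comp continuous_snd⟩
    have hπ_apply : ∀ (g : Γ) (a : A), π (g, a) = a q := fun _ _ => rfl
    have hπ : Function.Surjective π := fun y =>
      ⟨(1, (Pi.mulSingle q y : A)), by rw [hπ_apply]; exact Pi.mulSingle_eq_same _ _⟩
    exact freeProlRank_eq_top_of_surjective l π hπ
  refine ⟨E, B, ?_, hζ, not_thm26v_of_zetaInv_eq_zero E B hζ⟩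
  -- the splitting `G → Π`, `g ↦ (g, 1)`, over the open subgroup `G` itself
  refine ⟨⊤, (ContinuousMonoidHom.inl Γ A).comp ⟨(⊤ : Subgroup Γ).subtype, continuous_subtype_val⟩,
    ?_, fun u => rfl⟩
  rw [Subgroup.coe_top]
  exact isOpen_univ

/-- **FACT-LIST F-0249, universal closure REFUTED** (universe `0`): the typed [AbsTopI] Thm 2.6 (v)
(`FundamentalExtension.Thm26v`, case `Θ = {1}`) does not hold for EVERY abstract extension with MLF base data —
witness `G_{ℚ_2} × ∏_q ℤ_q^ℕ ↠ G_{ℚ_2}` (`exists_mlfBase_not_thm26v`).  The row is admissible only in its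
conditional / instance forms (`thm26v_of_coinvariantRankConstant`, `thm26v_of_starCondition`).
[cite: MochizukiAbsTopI2012, Thm 2.6 (v) p.22] -/
theorem not_forall_thm26v :
    ¬ ∀ (E : FundamentalExtension.{0}) (B : E.MLFBase), E.Thm26v B := by
  intro H
  obtain ⟨E, B, -, -, hE⟩ := exists_mlfBase_not_thm26v
  exact hE (H E B)

/-! ## F-0250: `Thm26vi` -/

/-- A continuous character `φ : Π → ℤ_l` that is non-trivial at some element of `Δ` violates the first
clause of the typed Thm 2.6 (vi) ("`Π^{ab-t} ↠ G^{ab-t}` is an isomorphism", typed as: every continuous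
`Π → ℤ_l` kills `Δ`). [cite: MochizukiAbsTopI2012, Thm 2.6 (vi) p.22] -/
theorem not_thm26vi_of_apply_ne_one (E : FundamentalExtension.{u}) {l : ℕ} [Fact l.Prime]
    (φ : E.arith →ₜ* Multiplicative ℤ_[l]) {x : E.arith} (hx : x ∈ E.geom) (hφ : φ x ≠ 1) :
    ¬ E.Thm26vi :=
  fun h => hφ (MonoidHom.mem_ker.mp ((h.1 l φ) hx))

/-- **F-0250, a model violating the typed Thm 2.6 (vi).**  The SPLIT extension `Π := G_ℚ × ℤ_2 ↠ G_ℚ`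
(first projection) with NF base datum `F = ℚ` splits over all of `G`, has `Δ = 1 × ℤ_2` topologically
finitely generated (by `(1, 1)`: `ℤ` is dense in `ℤ_2`) — so it satisfies the hypotheses "NF base",
"splitting" and "`Δ` tfg" (`GeomTFG`, [AbsTopI] Prop 2.2) — and violates `E.Thm26vi`: the second projection
`Π → ℤ_2` is a continuous character non-trivial on `Δ`.  What fails in print's terms is "`T_l(A)/G = 0`": the
`G`-coinvariants of `Δ^{ab} = ℤ_2` are all of `ℤ_2` (trivial action), as for no curve.
[cite: MochizukiAbsTopI2012, Thm 2.6 (vi) p.22] -/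
theorem exists_nfBase_not_thm26vi :
    ∃ (E : FundamentalExtension.{0}) (_ : E.NFBase),
      E.SplitsOverOpenSubgroup ∧ E.GeomTFG ∧ ¬ E.Thm26vi := by
  classical
  let Z : Type := Multiplicative ℤ_[2]
  let Γ : Type := Field.absoluteGaloisGroup ℚ
  let E : FundamentalExtension.{0} :=
    { arith := ProfiniteGrp.of (Γ × Z)
      gal := absoluteGaloisGrp ℚ
      aug := ContinuousMonoidHom.fst Γ Z
      aug_surjective := fun g => ⟨(g, 1), rfl⟩ }
  let B : E.NFBase := { F := ℚ, galIso := ContinuousMulEquiv.refl _ }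
  refine ⟨E, B, ?_, ?_, ?_⟩
  · -- the splitting `G → Π`, `g ↦ (g, 1)`
    refine ⟨⊤, (ContinuousMonoidHom.inl Γ Z).comp ⟨(⊤ : Subgroup Γ).subtype, continuous_subtype_val⟩,
      ?_, fun u => rfl⟩
    rw [Subgroup.coe_top]
    exact isOpen_univ
  · -- `ℤ_2` is topologically generated by `1`, and `Δ` is its image under `z ↦ (1, z)`
    have hd : DenseRange (fun k : ℤ => Multiplicative.ofAdd ((k : ℤ_[2]))) :=
      (Multiplicative.ofAdd.surjective.denseRange).comp PadicInt.denseRange_intCast continuous_ofAdd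
    have hsub : Set.range (fun k : ℤ => Multiplicative.ofAdd ((k : ℤ_[2]))) ⊆
        (Subgroup.zpowers (Multiplicative.ofAdd (1 : ℤ_[2])) : Set Z) := by
      rintro _ ⟨k, rfl⟩
      refine ⟨k, ?_⟩
      change Multiplicative.ofAdd (1 : ℤ_[2]) ^ k = Multiplicative.ofAdd (k : ℤ_[2])
      rw [← ofAdd_zsmul, zsmul_one]
    have hZ : IsTopologicallyFinitelyGenerated Z := by
      refine ⟨⟨{Multiplicative.ofAdd (1 : ℤ_[2])}, ?_⟩⟩
      apply SetLike.coe_injective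
      rw [Subgroup.topologicalClosure_coe, Subgroup.coe_top, Finset.coe_singleton,
        ← Subgroup.zpowers_eq_closure]
      exact (Dense.mono hsub hd).closure_eq
    let j : Z →ₜ* E.geom :=
      ⟨(MonoidHom.inr Γ Z).codRestrict E.geom fun z => E.mem_geom.mpr rfl,
        (continuous_const.prodMk continuous_id).subtype_mk _⟩
    have hj : Function.Surjective j := by
      rintro ⟨⟨g, z⟩, hgz⟩
      have hg : g = 1 := E.mem_geom.mp hgz
      subst hg
      exact ⟨z, rfl⟩
    exact hZ.of_surjective j hj
  · -- the second projection does not kill `(1, 1) ∈ Δ`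
    refine E.not_thm26vi_of_apply_ne_one (ContinuousMonoidHom.snd Γ Z)
      (x := ((1 : Γ), Multiplicative.ofAdd (1 : ℤ_[2]))) (E.mem_geom.mpr rfl) ?_
    change Multiplicative.ofAdd (1 : ℤ_[2]) ≠ 1
    rw [Ne, ofAdd_eq_one]
    exact one_ne_zero

/-- **FACT-LIST F-0250, universal closure REFUTED even over number-field base data** (universe `0`): the
typed [AbsTopI] Thm 2.6 (vi) (`FundamentalExtension.Thm26vi`) does not hold for every abstract extension with
`G ≅ G_F`, `F` a number field — witness `G_ℚ × ℤ_2 ↠ G_ℚ` (`exists_nfBase_not_thm26vi`).  The row is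
admissible only in its conditional form (`thm26vi_of_tfgNormalSubgroup_trivial`, with the Tate-module
hypothesis `hT`). [cite: MochizukiAbsTopI2012, Thm 2.6 (vi) p.22] -/
theorem not_forall_nfBase_thm26vi :
    ¬ ∀ (E : FundamentalExtension.{0}) (_B : E.NFBase), E.Thm26vi := by
  intro H
  obtain ⟨E, B, -, -, hE⟩ := exists_nfBase_not_thm26vi
  exact hE (H E B)

/-- **FACT-LIST F-0250, universal closure REFUTED** (the bare closure over the declared binder `E`).
[cite: MochizukiAbsTopI2012, Thm 2.6 (vi) p.22] -/
theorem not_forall_thm26vi : ¬ ∀ E : FundamentalExtension.{0}, E.Thm26vi :=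
  fun H => not_forall_nfBase_thm26vi fun E _ => H E

end FundamentalExtension

end Literature.AnabelianGeometry.AbsoluteAnabelian

end
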